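/-
Origin: expansion seat `planner-pub-hodgecm-pv06-g3-0`, handover #8 v3 2026-08-18T07:04:02Z (`HOME/pub-hodgecm-pv06-g3/lean/Pv06g3/AnnihilationModel.lean`, md5 a7b16269, 562 lines);
landed by the gen-7 packager in gate run 25 as `HodgeCM/PerL34/AnnihilationModel.lean` (import ^import Pv[0-9]+g[0-9]+\.→import HodgeCM.PerL34. ×1).
-/
/-
Origin: HOME/pub-hodgecm-pv06-g3/lean/Pv06g3/AnnihilationModel.lean — session planner-pub-hodgecm-pv06-g3-0 (unit pub-hodgecm-pv06-g3,
DAG-NODE PROVER #06 of 15, generation 3).  Intended final place: `HodgeCM/PerL34/AnnihilationModel.lean`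
(namespace `HodgeCM.PerL34.Annihilation`).  WIP import `Pv06g3.AnnihilationRep` ↦ `HodgeCM.PerL34.AnnihilationRep`; the other import is
LANDED (`HodgeCM.PerL34.CompactApprox`, run 24 — re-exports `QuotientSmoothingHaar`, `ApproxIdentity`; `HodgeCM.PerL34.ToricPeriodCov`,
`HodgeCM.PerL34.CharCompleteness`, run 22).  Closed: nothing cited, nothing posited.

# N23c over the cocompact MODEL: the core-side `[DEFINITIONAL]` fields of `RepAnnihilationDatum` CONSTRUCTED

Over the Mathlib model of `[U(W)]` used throughout the package (`G` a topological group, `Γ ≤ G`, `X = G ⧸ Γ` compact with a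
finite `G`-invariant Borel measure `ν`, `H = L²(X, ν)`, `R = QuotientSmoothing.ρHom ν` — exactly prl1-g3's `QuotientModel` /
`CoreModelData.toCore`), twelve fields of `RepAnnihilationDatum` (AnnihilationRep.lean) are DEFINITIONS and THEOREMS, not data:

* `Cf := C(G ⧸ Γ, ℂ)` (sup norm), `j := ContinuousMap.toLp 2 ν ℂ`, `Rc := translCHom` (`(R(g) y)(x) = y (g⁻¹ • x)`),
  `j_R` (`QuotientSmoothing.ρ_toLp`), `ev g := δ_{Γ g}` realised as `y ↦ y (↑g⁻¹)` (`evC`), `ev_R`, `ev_cont`, `ev_sep`, `Γ`,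
  `ev_left`, `Rc_cont` (continuity of translation on `C(X)`, from the compact-open topology), `R_cont`
  (`QuotientSmoothing.continuous_ρ_apply`).

and the four `[SETUP D7]` smoothing fields `sm, sm_tendsto, sm_mem, sm_cont` (packaged as `SmoothingData ν R`) are CONSTRUCTED
for Haar measure on a first-countable `G` (`smoothingData_haar`, §3: an approximate identity `ApproxIdentity.exists_isApproxIdentity`,
`smOp_tendsto`, `smOp_mem_of_invariant`, and `QuotientSmoothingHaar.sm_cont_haar'`).

§4 goes one step further for a COMPACT MODEL `K` of `[T]` (`CompactTorusDatum`): the characters of `[T]` are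
`PontryaginDual K`, the toric period is the Haar integral `periodCLM μK ξ` composed with the restriction `res` to `[T]`,
`PT_cov` [ELEMENTARY] is PROVED (`ToricPeriodCov.period_mul_right`) and `fourier` [PRINT] is PROVED with NO residual input
(`CharCompleteness.eq_zero_of_forall_character_orthogonal` + pv06-g2's KERNEL `CharSeparation.charSeparating`: characters of a
compact Hausdorff abelian group separate points).

What is left is the structure `QuotientTorusDatum ν C D` — the torus `T(L₀⊗ℝ) → U(W)(𝔸)` with its weight, the characters and
toric periods of `[T]`, the finite-adelic factor, and the three labelled non-definitional inputs `unfold` [AX12(ii)],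
`fourier` / `dense` [PRINT] (kernel supplements `CharCompleteness`, `AnnihilationDense`), verbatim in the model's terms — and

  `QuotientTorusDatum.toRep (A) (S : SmoothingData ν C.R) (hR : C.R = ρHom ν) : RepAnnihilationDatum C D`,
  `analytic_of_quotientTorusDatum : D.Analytic5 → QuotientTorusDatum ν C D → SmoothingData ν C.R → C.R = ρHom ν →`
  `  C.Analytic → D.Analytic`.
-/
import Summits.HodgeConjecture.HodgeCM.PerL34.CompactApprox
import Summits.HodgeConjecture.HodgeCM.PerL34.ToricPeriodCov
import Summits.HodgeConjecture.HodgeCM.PerL34.CharCompleteness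
import Summits.HodgeConjecture.HodgeCM.PerL34.AnnihilationRep

set_option autoImplicit false

noncomputable section

namespace HodgeCM
namespace PerL34.Annihilation

open MeasureTheory Filter Topology QuotientSmoothing

local notation "⟪" x ", " y "⟫" => @inner ℂ _ _ x y

/-! ## §1  Evaluation and translation on `C(G ⧸ Γ, ℂ)` -/
section Translation

variable {G : Type} [Group G] [TopologicalSpace G] {Γ : Subgroup G} [CompactSpace (G ⧸ Γ)]

/-- `ev g := δ_{Γ g}` on `C(G ⧸ Γ, ℂ)`, realised on Mathlib's left-coset space as `y ↦ y (↑g⁻¹)`. -/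
def evC (g : G) : C(G ⧸ Γ, ℂ) →L[ℂ] ℂ :=
  LinearMap.mkContinuous
    { toFun := fun y => y ((g⁻¹ : G) : G ⧸ Γ)
      map_add' := fun _ _ => rfl
      map_smul' := fun _ _ => rfl } 1 fun y => by
    rw [one_mul]
    exact y.norm_coe_le_norm _

/-- (Ported verbatim from the HodgeCMPerL package; no docstring in the source.) -/
@[simp] theorem evC_apply (g : G) (y : C(G ⧸ Γ, ℂ)) : evC g y = y ((g⁻¹ : G) : G ⧸ Γ) := rfl

/-- `ev_left`: `δ_{Γ γ g} = δ_{Γ g}` for `γ ∈ Γ`. -/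
theorem evC_left (γ : G) (hγ : γ ∈ Γ) (g : G) (y : C(G ⧸ Γ, ℂ)) : evC (γ * g) y = evC g y := by
  rw [evC_apply, evC_apply, mul_inv_rev, QuotientGroup.mk_mul_of_mem _ (inv_mem hγ)]

/-- `ev_sep`: the evaluations separate `C(G ⧸ Γ, ℂ)`. -/
theorem evC_sep (y : C(G ⧸ Γ, ℂ)) (h : ∀ g : G, evC g y = 0) : y = 0 := by
  ext x
  obtain ⟨g, rfl⟩ := QuotientGroup.mk_surjective x
  simpa only [evC_apply, inv_inv, ContinuousMap.zero_apply] using h g⁻¹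

variable [IsTopologicalGroup G]

/-- `ev_cont`: `g ↦ y(Γ g)` is continuous. -/
theorem continuous_evC (y : C(G ⧸ Γ, ℂ)) : Continuous fun g : G => evC g y := by
  simp only [evC_apply]
  exact y.continuous.comp (continuous_quot_mk.comp continuous_inv)

/-- `R(g)` on `C(G ⧸ Γ, ℂ)`: `(translC g y)(x) = y (g⁻¹ • x)`, i.e. `y.comp (act g)`; a contraction for the sup norm. -/
def translC (g : G) : C(G ⧸ Γ, ℂ) →L[ℂ] C(G ⧸ Γ, ℂ) :=
  LinearMap.mkContinuous
    { toFun := fun y => y.comp (act g)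
      map_add' := fun _ _ => rfl
      map_smul' := fun _ _ => rfl } 1 fun y => by
    rw [one_mul, ContinuousMap.norm_le _ (norm_nonneg _)]
    exact fun x => y.norm_coe_le_norm _

/-- (Ported verbatim from the HodgeCMPerL package; no docstring in the source.) -/
@[simp] theorem translC_apply (g : G) (y : C(G ⧸ Γ, ℂ)) : translC g y = y.comp (act g) := rfl

/-- (Ported verbatim from the HodgeCMPerL package; no docstring in the source.) -/
theorem translC_apply_apply (g : G) (y : C(G ⧸ Γ, ℂ)) (x : G ⧸ Γ) : translC g y x = y (g⁻¹ • x) := rfl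

/-- `g ↦ R(g)` is a homomorphism `G →* (C(G ⧸ Γ, ℂ) →L[ℂ] C(G ⧸ Γ, ℂ))`. -/
def translCHom : G →* (C(G ⧸ Γ, ℂ) →L[ℂ] C(G ⧸ Γ, ℂ)) where
  toFun := translC
  map_one' := ContinuousLinearMap.ext fun y => ContinuousMap.ext fun x => by
    show y ((1 : G)⁻¹ • x) = y x
    rw [inv_one, one_smul]
  map_mul' g h := ContinuousLinearMap.ext fun y => ContinuousMap.ext fun x => by
    show y ((g * h)⁻¹ • x) = y (h⁻¹ • (g⁻¹ • x))
    rw [mul_inv_rev, mul_smul]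

/-- (Ported verbatim from the HodgeCMPerL package; no docstring in the source.) -/
@[simp] theorem translCHom_apply (g : G) : (translCHom g : C(G ⧸ Γ, ℂ) →L[ℂ] C(G ⧸ Γ, ℂ)) = translC g := rfl

/-- **Continuity of translation on `C(G ⧸ Γ)`** (the field `Rc_cont`): `g ↦ R(g) y` is continuous for the sup norm —
the compact-open topology makes `f ↦ y ∘ f` continuous and `act : G → C(X, X)` is continuous. -/
theorem continuous_translC (y : C(G ⧸ Γ, ℂ)) : Continuous fun g : G => translC g y :=
  (ContinuousMap.continuous_postcomp y).comp (act (Γ := Γ)).continuous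

/-- `ev_R`: `δ_{Γ g} (R(h) y) = δ_{Γ g h} y`. -/
theorem evC_translC (g h : G) (y : C(G ⧸ Γ, ℂ)) : evC g (translC h y) = evC (g * h) y := by
  rw [evC_apply, evC_apply, translC_apply_apply, MulAction.Quotient.smul_coe, smul_eq_mul, mul_inv_rev]

end Translation

/-! ## §2  The reduced datum over the model and the constructor -/
section Model

variable {G : Type} [Group G] [TopologicalSpace G] [IsTopologicalGroup G] {Γ : Subgroup G}
  [MeasurableSpace (G ⧸ Γ)] [BorelSpace (G ⧸ Γ)] [CompactSpace (G ⧸ Γ)]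
  (ν : Measure (G ⧸ Γ)) [IsFiniteMeasure ν]
variable {HG CG SK SigIdxG : Type}
variable [NormedAddCommGroup HG] [InnerProductSpace ℂ HG] [CompleteSpace HG]
variable [NormedAddCommGroup CG] [NormedSpace ℂ CG] [TopologicalSpace SK]

/-- **[SETUP D7] smoothing data** for a representation `R` on `L²(G ⧸ Γ, ν)`: operators `R(f_n)` converging strongly to the
identity, preserving closed `R`-invariant subspaces, with values represented by continuous functions.  Constructed for Haar
measure in §3 (`smoothingData_haar`). -/
structure SmoothingData (R : G →* (Lp ℂ 2 ν →L[ℂ] Lp ℂ 2 ν)) where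
  /-- the smoothing operators `R(f_n)` -/
  sm : ℕ → (Lp ℂ 2 ν →L[ℂ] Lp ℂ 2 ν)
  sm_tendsto : ∀ v : Lp ℂ 2 ν, Tendsto (fun n => sm n v) atTop (𝓝 v)
  sm_mem : ∀ (M : Submodule ℂ (Lp ℂ 2 ν)), IsClosed (M : Set (Lp ℂ 2 ν)) → (∀ (g : G), ∀ v ∈ M, R g v ∈ M) →
    ∀ (n : ℕ), ∀ v ∈ M, sm n v ∈ M
  sm_cont : ∀ (n : ℕ) (v : Lp ℂ 2 ν), ∃ x : C(G ⧸ Γ, ℂ), ContinuousMap.toLp (E := ℂ) 2 ν ℂ x = sm n v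

/-- **The annihilation datum over the cocompact model, core side discharged.**  Fields = those of
`RepAnnihilationDatum` that are NOT definitional over `H = L²(G ⧸ Γ, ν)`, `Cf = C(G ⧸ Γ, ℂ)`, `j = toLp`, `R = ρHom ν`,
verbatim in the model's terms, plus the continuity of the torus embedding `ιT` (from which `Rc_cont`, `R_cont` follow);
WITHOUT the smoothing fields (`SmoothingData`, constructed in §3). -/
structure QuotientTorusDatum (C : RepCoreCarrier (Lp ℂ 2 ν) HG CG G SK SigIdxG) (D : RepTorusCarrier C) where
  /-- the compact group `T(L₀ ⊗ ℝ)` -/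
  Tc : Type
  [instTc₁ : Group Tc]
  [instTc₂ : TopologicalSpace Tc]
  [instTc₃ : IsTopologicalGroup Tc]
  [instTc₄ : CompactSpace Tc]
  [instTc₅ : MeasurableSpace Tc]
  [instTc₆ : BorelSpace Tc]
  /-- its normalised Haar measure -/
  μ : Measure Tc
  [instμ₁ : IsProbabilityMeasure μ]
  [instμ₂ : μ.IsMulLeftInvariant]
  /-- the embedding `T(L₀ ⊗ ℝ) → U(W)(𝔸)`, a continuous homomorphism -/
  ιT : Tc →* G
  ιT_cont : Continuous ιT
  /-- the weight character `w = χ_∞|_{T(L₀⊗ℝ)}` of the isolated type, continuous and unitary -/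
  w : Tc →* ℂ
  w_cont : Continuous w
  w_norm : ∀ t, ‖w t‖ = 1
  /-- the torus side's weight space IS the joint eigenspace of `(ιT, w)` (`rfl` when `D.torus = ⇑ιT`, `D.w = ⇑w`). -/
  Ew_eq : D.Ew = RepDecomp.Ew C.R ιT w
  /-- all unitary characters of `[T]` -/
  Xall : Type
  /-- the allowed characters among them -/
  emb : D.X → Xall
  /-- the archimedean component `ξ_∞|_{T(L₀⊗ℝ)}` of a character of `[T]` -/
  χinf : Xall → (Tc →* ℂ)
  /-- ll. 425–427: a character of `[T]` with `ξ_∞ = w` is allowed. -/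
  emb_surj : ∀ ξ : Xall, χinf ξ = w → ∃ χ : D.X, emb χ = ξ
  /-- the toric period `P_{T,ξ̄}` on `C([U(W)]) = C(G ⧸ Γ, ℂ)` -/
  PT : Xall → (C(G ⧸ Γ, ℂ) →L[ℂ] ℂ)
  /-- [ELEMENTARY] ll. 427–429 (kernel supplement `ToricPeriodCov`): covariance of the toric period. -/
  PT_cov : ∀ (ξ : Xall) (t : Tc) (x : C(G ⧸ Γ, ℂ)), PT ξ (translC (ιT t) x) = χinf ξ t * PT ξ x
  /-- the finite-adelic factor `U(W)(𝔸_f)` -/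
  Gf : Type
  [instGf : Group Gf]
  /-- its inclusion into `U(W)(𝔸)` -/
  ιf : Gf →* G
  /-- `U(W)(𝔸_f)` commutes with `T(L₀ ⊗ ℝ)` -/
  comm : ∀ (hf : Gf) (t : Tc), ιf hf * ιT t = ιT t * ιf hf
  /-- [AX12(ii)] the unfolding identity, in the consequence form Step 2 consumes (verbatim `RepAnnihilationDatum.unfold`
  with `j = toLp`, `Rc = translC`). -/
  unfold : ∀ (x : C(G ⧸ Γ, ℂ)) (χ : D.X), (∀ f, ⟪D.E χ f, ContinuousMap.toLp (E := ℂ) 2 ν ℂ x⟫ = 0) →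
    ∀ h : G, PT (emb χ) (translC h x) = 0
  /-- the points of `[T]`, mapped into `U(W)(𝔸)` -/
  TA : Type
  ιA : TA → G
  /-- [PRINT] Fourier analysis on the compact abelian group `[T]` (kernel supplement `CharCompleteness`). -/
  fourier : ∀ x : C(G ⧸ Γ, ℂ), (∀ ξ : Xall, PT ξ x = 0) → ∀ t : TA, evC (ιA t) x = 0
  /-- [PRINT] `U(W)(L₀) · [T] · U(W)(𝔸_f)` is dense in `U(W)(𝔸)` (kernel supplement `AnnihilationDense`). -/
  dense : Dense {g : G | ∃ γ ∈ Γ, ∃ (t : TA) (hf : Gf), g = γ * ιA t * ιf hf}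

attribute [instance] QuotientTorusDatum.instTc₁ QuotientTorusDatum.instTc₂ QuotientTorusDatum.instTc₃
  QuotientTorusDatum.instTc₄ QuotientTorusDatum.instTc₅ QuotientTorusDatum.instTc₆
  QuotientTorusDatum.instμ₁ QuotientTorusDatum.instμ₂ QuotientTorusDatum.instGf

namespace QuotientTorusDatum

variable {ν}
variable [SMulInvariantMeasure G (G ⧸ Γ) ν] [T2Space (G ⧸ Γ)] [ν.InnerRegularCompactLTTop]
variable {C : RepCoreCarrier (Lp ℂ 2 ν) HG CG G SK SigIdxG} {D : RepTorusCarrier C}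

/-- **The full `RepAnnihilationDatum` of a model torus datum and smoothing data**: the twelve core-side fields are supplied
by §1 and `QuotientSmoothing` (`j_R = ρ_toLp`, `R_cont = continuous_ρ_apply`). -/
def toRep (A : QuotientTorusDatum ν C D) (S : SmoothingData ν C.R) (hR : C.R = ρHom ν) : RepAnnihilationDatum C D where
  Cf := C(G ⧸ Γ, ℂ)
  j := ContinuousMap.toLp (E := ℂ) 2 ν ℂ
  Rc := translCHom
  j_R g x := by
    rw [hR, ρHom_apply, translCHom_apply, translC_apply]
    exact (ρ_toLp ν g x).symm
  ev := evC
  ev_R g h x := evC_translC g h x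
  ev_cont := continuous_evC
  ev_sep := evC_sep
  Γ := Γ
  ev_left := evC_left
  Tc := A.Tc
  μ := A.μ
  ιT := A.ιT
  w := A.w
  w_cont := A.w_cont
  w_norm := A.w_norm
  Rc_cont x := (continuous_translC x).comp A.ιT_cont
  R_cont v := by
    rw [hR]
    exact (continuous_ρ_apply ν v).comp A.ιT_cont
  Ew_eq := A.Ew_eq
  Xall := A.Xall
  emb := A.emb
  χinf := A.χinf
  emb_surj := A.emb_surj
  PT := A.PT
  PT_cov := A.PT_cov
  Gf := A.Gf
  ιf := A.ιf
  comm := A.comm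
  unfold := A.unfold
  TA := A.TA
  ιA := A.ιA
  fourier := A.fourier
  dense := A.dense
  sm := S.sm
  sm_tendsto := S.sm_tendsto
  sm_mem := S.sm_mem
  sm_cont := S.sm_cont

/-- **AX8 over the model** from a model torus datum. -/
theorem AX8_annihilation (A : QuotientTorusDatum ν C D) (S : SmoothingData ν C.R) (hR : C.R = ρHom ν)
    (hC : C.Analytic) (h12a : ∀ (h : G) χ f, C.R h (D.E χ f) = D.E χ (D.ETransl h χ f)) (v : Lp ℂ 2 ν)
    (hv : ∀ χ f, ⟪D.E χ f, v⟫ = 0) : D.toTorusCarrier.Pw v = 0 :=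
  (A.toRep S hR).AX8_annihilation hC h12a v hv

end QuotientTorusDatum

end Model

section Consequence

variable {G : Type} [Group G] [TopologicalSpace G] [IsTopologicalGroup G] {Γ : Subgroup G}
  [MeasurableSpace (G ⧸ Γ)] [BorelSpace (G ⧸ Γ)] [CompactSpace (G ⧸ Γ)]
variable {HG CG SK SigIdxG : Type}
variable [NormedAddCommGroup HG] [InnerProductSpace ℂ HG] [CompleteSpace HG]
variable [NormedAddCommGroup CG] [NormedSpace ℂ CG] [TopologicalSpace SK]

/-- **`RepTorusCarrier.Analytic` over the model** = `Analytic5` + a `QuotientTorusDatum` + `SmoothingData` (given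
`R = ρHom ν` and the core's AX9): AX8 and the twelve core-side fields of the annihilation datum are no longer inputs. -/
theorem analytic_of_quotientTorusDatum {ν : Measure (G ⧸ Γ)} [IsFiniteMeasure ν] [SMulInvariantMeasure G (G ⧸ Γ) ν] [T2Space (G ⧸ Γ)]
    [ν.InnerRegularCompactLTTop] {C : RepCoreCarrier (Lp ℂ 2 ν) HG CG G SK SigIdxG} {D : RepTorusCarrier C}
    (h5 : D.Analytic5) (A : QuotientTorusDatum ν C D) (S : SmoothingData ν C.R) (hR : C.R = ρHom ν)
    (hC : C.Analytic) : D.Analytic :=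
  analytic_of_analytic5 h5 (A.toRep S hR) hC

end Consequence

/-! ## §4  Toric periods over a compact model of `[T]`: `PT`, `PT_cov`, `fourier` CONSTRUCTED

`[T] = T(L₀)\T(𝔸)` is a compact group `K`; a continuous unitary character is `ξ : PontryaginDual K`; the toric period of
`F ∈ C(K, ℂ)` is `P_ξ̄(F) = ∫_K F(k) conj(ξ k) dμ_K(k)` (`periodCLM`).  Right-translation covariance is
`ToricPeriodCov.period_mul_right`; "all periods vanish ⇒ `F = 0`" is `CharCompleteness.eq_zero_of_forall_character_orthogonal`
given that the characters separate points — a KERNEL theorem for compact Hausdorff abelian `K` (`CharSeparation.charSeparating`). -/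
section CompactPeriods

variable {K : Type} [Group K] [TopologicalSpace K] [IsTopologicalGroup K] [CompactSpace K]
  [MeasurableSpace K] [BorelSpace K] (μK : Measure K) [IsFiniteMeasure μK]

omit [IsTopologicalGroup K] [CompactSpace K] [MeasurableSpace K] [BorelSpace K] in
/-- A continuous unitary character of `K` as a homomorphism `K →* ℂ`. -/
def dualChar (ξ : PontryaginDual K) : K →* ℂ := Circle.coeHom.comp ξ.toMonoidHom

omit [IsTopologicalGroup K] [CompactSpace K] [MeasurableSpace K] [BorelSpace K] in
/-- (Ported verbatim from the HodgeCMPerL package; no docstring in the source.) -/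
@[simp] theorem dualChar_apply (ξ : PontryaginDual K) (k : K) : dualChar ξ k = ((ξ k : Circle) : ℂ) := rfl

omit [IsTopologicalGroup K] [CompactSpace K] [MeasurableSpace K] [BorelSpace K] in
/-- (Ported verbatim from the HodgeCMPerL package; no docstring in the source.) -/
theorem norm_dualChar (ξ : PontryaginDual K) (k : K) : ‖dualChar ξ k‖ = 1 := Circle.norm_coe _

omit [IsTopologicalGroup K] [CompactSpace K] [MeasurableSpace K] [BorelSpace K] in
/-- (Ported verbatim from the HodgeCMPerL package; no docstring in the source.) -/
theorem continuous_dualChar (ξ : PontryaginDual K) : Continuous (dualChar ξ) :=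
  continuous_subtype_val.comp (map_continuous ξ)

omit [IsTopologicalGroup K] in
/-- (Ported verbatim from the HodgeCMPerL package; no docstring in the source.) -/
theorem integrable_mul_conj_dualChar (ξ : PontryaginDual K) (F : C(K, ℂ)) :
    Integrable (fun k => F k * starRingEnd ℂ (dualChar ξ k)) μK :=
  ((map_continuous F).mul (Complex.continuous_conj.comp (continuous_dualChar ξ))).integrable_of_hasCompactSupport
    (HasCompactSupport.of_compactSpace _)

omit [IsTopologicalGroup K] in
/-- **The toric period** `P_ξ̄ : C(K, ℂ) →L[ℂ] ℂ`, `F ↦ ∫_K F(k) conj(ξ k) dμ_K`. -/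
def periodCLM (ξ : PontryaginDual K) : C(K, ℂ) →L[ℂ] ℂ :=
  LinearMap.mkContinuous
    ({ toFun := fun F => ∫ k, F k * starRingEnd ℂ (dualChar ξ k) ∂μK
       map_add' := fun F₁ F₂ => by
         simp only [ContinuousMap.add_apply, add_mul]
         exact integral_add (integrable_mul_conj_dualChar μK ξ F₁) (integrable_mul_conj_dualChar μK ξ F₂)
       map_smul' := fun c F => by
         simp only [ContinuousMap.smul_apply, smul_eq_mul, mul_assoc, RingHom.id_apply]
         exact integral_const_mul c _ } : C(K, ℂ) →ₗ[ℂ] ℂ)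
    (μK.real Set.univ) (fun F => by
      rw [mul_comm]
      refine norm_integral_le_of_norm_le_const (Filter.Eventually.of_forall fun k => ?_)
      rw [norm_mul, RCLike.norm_conj, norm_dualChar, mul_one]
      exact F.norm_coe_le_norm k)

omit [IsTopologicalGroup K] in
/-- (Ported verbatim from the HodgeCMPerL package; no docstring in the source.) -/
@[simp] theorem periodCLM_apply (ξ : PontryaginDual K) (F : C(K, ℂ)) :
    periodCLM μK ξ F = ∫ k, F k * starRingEnd ℂ (dualChar ξ k) ∂μK := rfl

/-- Covariance under right translation (`ToricPeriodCov.period_mul_right`). -/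
theorem periodCLM_translate [μK.IsMulRightInvariant] (ξ : PontryaginDual K) (F Fs : C(K, ℂ)) (s : K)
    (hFs : ∀ k, Fs k = F (k * s)) : periodCLM μK ξ Fs = dualChar ξ s * periodCLM μK ξ F := by
  simp only [periodCLM_apply, hFs]
  exact ToricPeriodCov.period_mul_right μK (dualChar ξ) (norm_dualChar ξ) F s

omit [IsTopologicalGroup K] in
/-- All toric periods vanish ⇒ `F = 0` (`CharCompleteness`, from point separation by characters). -/
theorem eq_zero_of_forall_periodCLM [μK.IsOpenPosMeasure]
    (hsep : ∀ k₁ k₂ : K, k₁ ≠ k₂ → ∃ χ : PontryaginDual K, χ k₁ ≠ χ k₂)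
    (F : C(K, ℂ)) (h : ∀ ξ : PontryaginDual K, periodCLM μK ξ F = 0) : F = 0 :=
  CharCompleteness.eq_zero_of_forall_character_orthogonal μK hsep F fun χ => by
    rw [← h χ, periodCLM_apply]
    refine integral_congr_ae (Filter.Eventually.of_forall fun k => ?_)
    show star ((χ k : Circle) : ℂ) * F k = F k * starRingEnd ℂ ((χ k : Circle) : ℂ)
    rw [mul_comm]
    rfl

end CompactPeriods

section CompactModel

variable {G : Type} [Group G] [TopologicalSpace G] [IsTopologicalGroup G] {Γ : Subgroup G}
  [MeasurableSpace (G ⧸ Γ)] [BorelSpace (G ⧸ Γ)] [CompactSpace (G ⧸ Γ)]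
  (ν : Measure (G ⧸ Γ)) [IsFiniteMeasure ν]
variable {HG CG SK SigIdxG : Type}
variable [NormedAddCommGroup HG] [InnerProductSpace ℂ HG] [CompleteSpace HG]
variable [NormedAddCommGroup CG] [NormedSpace ℂ CG] [TopologicalSpace SK]

/-- **The restriction `res` from a continuous map `φ : [T] → [U(W)]`**: `res x := x ∘ φ` as a continuous linear map
`C(G ⧸ Γ, ℂ) →L[ℂ] C(K, ℂ)` (norm ≤ 1). -/
def resCLM {K : Type} [TopologicalSpace K] [CompactSpace K] (φ : C(K, G ⧸ Γ)) : C(G ⧸ Γ, ℂ) →L[ℂ] C(K, ℂ) :=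
  LinearMap.mkContinuous
    ({ toFun := fun x => x.comp φ
       map_add' := fun _ _ => rfl
       map_smul' := fun _ _ => rfl } : C(G ⧸ Γ, ℂ) →ₗ[ℂ] C(K, ℂ)) 1
    (fun x => by
      rw [one_mul]
      exact (ContinuousMap.norm_le _ (norm_nonneg _)).mpr fun k => x.norm_coe_le_norm (φ k))

omit [IsTopologicalGroup G] [MeasurableSpace (G ⧸ Γ)] [BorelSpace (G ⧸ Γ)] in
/-- (Ported verbatim from the HodgeCMPerL package; no docstring in the source.) -/
@[simp] theorem resCLM_apply {K : Type} [TopologicalSpace K] [CompactSpace K] (φ : C(K, G ⧸ Γ)) (x : C(G ⧸ Γ, ℂ)) (k : K) :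
    resCLM φ x k = x (φ k) := rfl


-- port_pkg: scope closed for this part
end CompactModel
end PerL34.Annihilation
end HodgeCM
end
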